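import Summits.QuantumFields.BalabanUV.Beta.GAN24.FibreRateFeed
import Summits.QuantumFields.BalabanUV.Beta.GAN24.FibreRate

/-!
# `BalabanUV.Beta.GAN24.FineReadoutCauchyCap` — PART C of «(N1-Cauchy)», WIRED FROM THE TREE: the two-level REAL-ZONE rates (and `N`-uniform sizes) of the BORDER
# UNKNOWNS `(φ, c)` of the Q-SOURCE minimiser column, in the capacitance unit `N^{D+4}`, are road P1's capacitance rates BY NAME

**G-an2-4 FORMALISATION SWARM, b2b-balaban-gan24-formalise-leaf-13 (gen 18) — PART C of the located leaf «(N1-Cauchy)» of the S3 RATE table** (owner's typed spec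
`HOME/b2b-balaban-gan24-p1/N1-CAUCHY-SPEC.md` v1; holder leaf-17, division `HOME/b2b-balaban-gan24-formalise-leaf-17/g11/N1-CAUCHY-DIVISION.md` §4 «PART C — the (φ, c) two-level
rate at SYMBOL level … SAY which tree lemma exports it»; HOLDER RULING CLAIMS l.5161: «PART C = the TREE's `CapacitanceRateScaled.scaled_cap_inv_inl_inl_rate` ∕ `_inr_inl_rate` +
`CapacitanceRateDictionary` sizes BY NAME; leaf-13 keeps the wiring + the real assembly `GAN24/FineReadoutCauchyReal`»).  NOT IN PRINT; OUR PROOF ATTEMPT.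
[folklore] wiring — every estimate is leaf-20 ∕ L11's (road P1, `FibreRate` chain), imported BY NAME; no new analysis, no cited fact, no `def`, no wall binder.

HONEST FRAMING (verbatim): «discharging `BetaPertH` makes Bałaban's UV stability UNCONDITIONAL — a real constructive-QFT result; it is NOT the continuum limit and NOT the
Clay problem.»  HONEST DEPENDENCY (verbatim): «continuum YM on T⁴ ⇐ BetaPertH ∧ nine spine estimates (0/9 proved); BetaPertH ⇐ (D1) ∧ (D4) ∧ CAP+tail; G-an2-4 gates asym, D1
and NE2/3/4.»  Discharges NOTHING of «(N1-Cauchy)» by itself (PART A∕K∕S consume it), of «E3SupRate»∕«E3Shape», of (hS, hSall); NOT BetaPertH, NOT continuum, NOT Clay.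

## The objects
The border unknowns of the Q-source column at real momentum `p = ofRealVec q` are T00's `phiSol N p 0 (eVec l)` (the constraint multipliers) and
`cSol N p 0 (eVec l)` (the block gauge constant): `f̂ = 0`, `ĉ = e_l` (`AliasObjects`; `FibreRateMM.phiSol_zero_eVec`: `φ_κ = (cap N p)⁻¹ (inl κ) (inl l)`;
`FibreRateFeed.cSol_zero_eVec`: `c = (cap N p)⁻¹ (inr ()) (inl l)`) — the objects inside leaf-16-g9's PART A amplitude `Ahat N (ofRealVec q) 0 (eVec l)` (CLAIMS l.5016 (5)).
Their natural `O(1)` unit is `N^{D+4}` (`CapacitanceRateDictionary.scaled_cap_inv_*`; E3A's `column_apriori` (iii)(iv) bounds `‖φ‖, ‖c‖ ≲ N^{−(D+4)}` likewise).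

## What is proved (generic `D`; real `q ∈ [−π, π]^D`, `q ≠ 0`; `1 ≤ N ≤ N′`)
* §1 SIZES: `norm_unit_phiSolQ_le` (`‖N^{D+4}·φ_N κ‖ ≤ cPP D·|q|²`), `norm_unit_cSolQ_le` (`‖N^{D+4}·c_N‖ ≤ cPc D·|q|²√|q|²`).
* §2 RATES: **`norm_unit_phiSolQ_sub_le`** (`‖N′^{D+4}·φ_{N′} κ − N^{D+4}·φ_N κ‖ ≤ crPP D·|q|⁴∕N²`), **`norm_unit_cSolQ_sub_le`** (`‖N′^{D+4}·c_{N′} − N^{D+4}·c_N‖ ≤ crPc D·|q|⁴√|q|²∕N²`).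
* §3 ZONE-UNIFORM constants (`|q|² ≤ D·π²`): `…_le_unif`, `…_sub_le_unif`.
* §4 THE STEP FORM for the consecutive blockings `N = Lc^(n+1) ≤ N′ = Lc^(n+2)` of the S3 RATE table: `1∕N² = (Lc⁻²)^(n+1)`, so both rates are `n`-GEOMETRIC with
  `θ = Lc⁻²` — `norm_unit_phiSolQ_step_le`, `norm_unit_cSolQ_step_le` (the shape PART S multiplies by leaf-16's majorant and sums over the aliases).
Unit `b2b-balaban-gan24-formalise-leaf-13` (gen 18; records first), 2026-08-20.
-/

noncomputable section

open Complex Finset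
open scoped BigOperators Real

namespace Summit.QuantumFields.BalabanUV.Beta.GAN24.FineReadoutCauchyCap

open Literature.MathematicalPhysics.QuantumFieldTheory.Balaban1983to89.B4Strip (ofRealVec)
open Literature.MathematicalPhysics.QuantumFieldTheory.King1986 (momSq momSq_nonneg)
open AliasObjects (cap phiSol cSol eVec)
open CapacitanceEndpointBlocks (cPP cPc cPP_pos cPc_pos)
open CapacitanceRateDictionary (scaled_cap_inv_inl_inl scaled_cap_inv_inr_inl norm_invPP_aT_le norm_invcP_aT_le)
open CapacitanceRateScaled (crPP crPc scaled_cap_inv_inl_inl_rate scaled_cap_inv_inr_inl_rate momSq_le)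
open FibreRateOfLegs (crPP_nonneg)
open FibreRate (crPc_nonneg)
open FibreRateMM (phiSol_zero_eVec)
open FibreRateFeed (cSol_zero_eVec)

variable {D : ℕ} {N N' : ℕ} [NeZero N] [NeZero N'] {q : Fin D → ℝ}

/-! ## §1 Sizes, `N`-uniform -/

/-- [folklore] **SIZE OF THE UNIT CONSTRAINT MULTIPLIER of the Q-source column**: `‖N^{D+4}·φ_N κ‖ ≤ cPP D·|q|²` (`phiSol_zero_eVec` + `scaled_cap_inv_inl_inl` + `norm_invPP_aT_le`). -/
theorem norm_unit_phiSolQ_le (hN : 1 ≤ N) (hq : ∀ i, |q i| ≤ π) (hq0 : q ≠ 0) (l κ : Fin D) :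
    ‖(N : ℂ) ^ (D + 4) * phiSol N (ofRealVec q) 0 (eVec l) κ‖ ≤ cPP D * momSq q := by
  rw [phiSol_zero_eVec, scaled_cap_inv_inl_inl hN hq hq0]
  exact norm_invPP_aT_le hN hq hq0 κ l

/-- [folklore] **SIZE OF THE UNIT BLOCK GAUGE CONSTANT of the Q-source column**: `‖N^{D+4}·c_N‖ ≤ cPc D·|q|²√|q|²` (`cSol_zero_eVec` + `scaled_cap_inv_inr_inl` + `norm_invcP_aT_le`). -/
theorem norm_unit_cSolQ_le (hN : 1 ≤ N) (hq : ∀ i, |q i| ≤ π) (hq0 : q ≠ 0) (l : Fin D) :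
    ‖(N : ℂ) ^ (D + 4) * cSol N (ofRealVec q) 0 (eVec l)‖ ≤ cPc D * (momSq q * Real.sqrt (momSq q)) := by
  rw [cSol_zero_eVec, scaled_cap_inv_inr_inl hN hq hq0]
  exact norm_invcP_aT_le hN hq hq0 l

/-! ## §2 Two-level rates, any `1 ≤ N ≤ N′` -/

/-- [folklore] **TWO-LEVEL RATE OF THE UNIT CONSTRAINT MULTIPLIER** (PART C, φ-half): `‖N′^{D+4}·φ_{N′} κ − N^{D+4}·φ_N κ‖ ≤ crPP D·|q|⁴∕N²`
— road P1's `CapacitanceRateScaled.scaled_cap_inv_inl_inl_rate` read through `phiSol_zero_eVec`. -/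
theorem norm_unit_phiSolQ_sub_le (hN : 1 ≤ N) (hNN' : N ≤ N') (hq : ∀ i, |q i| ≤ π) (hq0 : q ≠ 0) (l κ : Fin D) :
    ‖(N' : ℂ) ^ (D + 4) * phiSol N' (ofRealVec q) 0 (eVec l) κ - (N : ℂ) ^ (D + 4) * phiSol N (ofRealVec q) 0 (eVec l) κ‖
      ≤ crPP D * momSq q ^ 2 / (N : ℝ) ^ 2 := by
  rw [phiSol_zero_eVec, phiSol_zero_eVec]
  exact scaled_cap_inv_inl_inl_rate hN hNN' hq hq0 κ l

/-- [folklore] **TWO-LEVEL RATE OF THE UNIT BLOCK GAUGE CONSTANT** (PART C, c-half): `‖N′^{D+4}·c_{N′} − N^{D+4}·c_N‖ ≤ crPc D·|q|⁴√|q|²∕N²`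
— road P1's `CapacitanceRateScaled.scaled_cap_inv_inr_inl_rate` read through `cSol_zero_eVec`. -/
theorem norm_unit_cSolQ_sub_le (hN : 1 ≤ N) (hNN' : N ≤ N') (hq : ∀ i, |q i| ≤ π) (hq0 : q ≠ 0) (l : Fin D) :
    ‖(N' : ℂ) ^ (D + 4) * cSol N' (ofRealVec q) 0 (eVec l) - (N : ℂ) ^ (D + 4) * cSol N (ofRealVec q) 0 (eVec l)‖
      ≤ crPc D * (momSq q ^ 2 * Real.sqrt (momSq q)) / (N : ℝ) ^ 2 := by
  rw [cSol_zero_eVec, cSol_zero_eVec]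
  exact scaled_cap_inv_inr_inl_rate hN hNN' hq hq0 () l

/-! ## §3 Zone-uniform constants (`|q|² ≤ D·π²`) -/

/-- [folklore] `√(momSq q) ≤ √D·π` on the zone. -/
theorem sqrt_momSq_le_sqrt_mul_pi (hq : ∀ i, |q i| ≤ π) : Real.sqrt (momSq q) ≤ Real.sqrt D * π := by
  rw [← Real.sqrt_sq Real.pi_pos.le, ← Real.sqrt_mul (Nat.cast_nonneg D)]
  exact Real.sqrt_le_sqrt (momSq_le hq)

/-- [folklore] Zone-uniform size of the unit constraint multiplier: `≤ cPP D·(D·π²)`. -/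
theorem norm_unit_phiSolQ_le_unif (hN : 1 ≤ N) (hq : ∀ i, |q i| ≤ π) (hq0 : q ≠ 0) (l κ : Fin D) :
    ‖(N : ℂ) ^ (D + 4) * phiSol N (ofRealVec q) 0 (eVec l) κ‖ ≤ cPP D * (D * π ^ 2) :=
  (norm_unit_phiSolQ_le hN hq hq0 l κ).trans (mul_le_mul_of_nonneg_left (momSq_le hq) (cPP_pos D).le)

/-- [folklore] Zone-uniform size of the unit block gauge constant: `≤ cPc D·((D·π²)·(√D·π))`. -/
theorem norm_unit_cSolQ_le_unif (hN : 1 ≤ N) (hq : ∀ i, |q i| ≤ π) (hq0 : q ≠ 0) (l : Fin D) :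
    ‖(N : ℂ) ^ (D + 4) * cSol N (ofRealVec q) 0 (eVec l)‖ ≤ cPc D * ((D * π ^ 2) * (Real.sqrt D * π)) := by
  refine (norm_unit_cSolQ_le hN hq hq0 l).trans (mul_le_mul_of_nonneg_left ?_ (cPc_pos D).le)
  exact mul_le_mul (momSq_le hq) (sqrt_momSq_le_sqrt_mul_pi hq) (Real.sqrt_nonneg _) (by positivity)

/-- [folklore] Zone-uniform φ-rate: `≤ crPP D·(D·π²)²∕N²`. -/
theorem norm_unit_phiSolQ_sub_le_unif (hN : 1 ≤ N) (hNN' : N ≤ N') (hq : ∀ i, |q i| ≤ π) (hq0 : q ≠ 0) (l κ : Fin D) :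
    ‖(N' : ℂ) ^ (D + 4) * phiSol N' (ofRealVec q) 0 (eVec l) κ - (N : ℂ) ^ (D + 4) * phiSol N (ofRealVec q) 0 (eVec l) κ‖
      ≤ crPP D * (D * π ^ 2) ^ 2 / (N : ℝ) ^ 2 := by
  have hN0 : (0 : ℝ) < N := by exact_mod_cast hN
  refine (norm_unit_phiSolQ_sub_le hN hNN' hq hq0 l κ).trans ?_
  refine div_le_div_of_nonneg_right (mul_le_mul_of_nonneg_left ?_ (crPP_nonneg D)) (by positivity)
  exact pow_le_pow_left₀ (momSq_nonneg q) (momSq_le hq) 2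

/-- [folklore] Zone-uniform c-rate: `≤ crPc D·((D·π²)²·(√D·π))∕N²`. -/
theorem norm_unit_cSolQ_sub_le_unif (hN : 1 ≤ N) (hNN' : N ≤ N') (hq : ∀ i, |q i| ≤ π) (hq0 : q ≠ 0) (l : Fin D) :
    ‖(N' : ℂ) ^ (D + 4) * cSol N' (ofRealVec q) 0 (eVec l) - (N : ℂ) ^ (D + 4) * cSol N (ofRealVec q) 0 (eVec l)‖
      ≤ crPc D * ((D * π ^ 2) ^ 2 * (Real.sqrt D * π)) / (N : ℝ) ^ 2 := by
  have hN0 : (0 : ℝ) < N := by exact_mod_cast hN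
  refine (norm_unit_cSolQ_sub_le hN hNN' hq hq0 l).trans ?_
  refine div_le_div_of_nonneg_right (mul_le_mul_of_nonneg_left ?_ (crPc_nonneg D)) (by positivity)
  exact mul_le_mul (pow_le_pow_left₀ (momSq_nonneg q) (momSq_le hq) 2) (sqrt_momSq_le_sqrt_mul_pi hq) (Real.sqrt_nonneg _) (by positivity)

/-! ## §4 The step form: consecutive blockings `Lc^(n+1) ≤ Lc^(n+2)` — `n`-geometric, `θ = Lc⁻²` -/

section Step

variable {Lc : ℕ} [NeZero Lc]

omit [NeZero Lc] in
/-- [folklore] `1 ≤ Lc^(n+1) ≤ Lc^(n+2)` for `Lc ≥ 1`. -/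
theorem one_le_pow_and_le (hLc : 1 ≤ Lc) (n : ℕ) : 1 ≤ Lc ^ (n + 1) ∧ Lc ^ (n + 1) ≤ Lc ^ (n + 2) :=
  ⟨Nat.one_le_pow _ _ (by omega), Nat.pow_le_pow_right (by omega) (by omega)⟩

omit [NeZero Lc] in
/-- [folklore] `1∕(Lc^(n+1))² = Lc⁻²·(Lc⁻²)^n`. -/
theorem inv_sq_pow_eq (n : ℕ) : (1 : ℝ) / (((Lc ^ (n + 1) : ℕ) : ℝ)) ^ 2 = ((Lc : ℝ) ^ 2)⁻¹ * (((Lc : ℝ) ^ 2)⁻¹) ^ n := by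
  have h1 : (((Lc ^ (n + 1) : ℕ) : ℝ)) ^ 2 = ((Lc : ℝ) ^ 2) ^ (n + 1) := by push_cast; ring
  rw [h1, one_div, ← inv_pow, pow_succ']

/-- [folklore] **PART C, φ-HALF, STEP FORM**: for the consecutive blockings of the S3 RATE table, uniformly on `[−π, π]^D ∖ {0}`,
`‖(Lc^(n+2))^{D+4}·φ_{Lc^(n+2)} κ − (Lc^(n+1))^{D+4}·φ_{Lc^(n+1)} κ‖ ≤ (crPP D·(D·π²)²∕Lc²)·(Lc⁻²)^n`. -/
theorem norm_unit_phiSolQ_step_le (hLc : 1 ≤ Lc) (n : ℕ) (hq : ∀ i, |q i| ≤ π) (hq0 : q ≠ 0) (l κ : Fin D) :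
    ‖(((Lc ^ (n + 2) : ℕ) : ℂ)) ^ (D + 4) * phiSol (Lc ^ (n + 2)) (ofRealVec q) 0 (eVec l) κ
        - (((Lc ^ (n + 1) : ℕ) : ℂ)) ^ (D + 4) * phiSol (Lc ^ (n + 1)) (ofRealVec q) 0 (eVec l) κ‖
      ≤ (crPP D * (D * π ^ 2) ^ 2 * ((Lc : ℝ) ^ 2)⁻¹) * (((Lc : ℝ) ^ 2)⁻¹) ^ n := by
  obtain ⟨h1, h2⟩ := one_le_pow_and_le hLc n
  haveI : NeZero (Lc ^ (n + 1)) := ⟨by positivity⟩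
  haveI : NeZero (Lc ^ (n + 2)) := ⟨by positivity⟩
  refine (norm_unit_phiSolQ_sub_le_unif h1 h2 hq hq0 l κ).trans (le_of_eq ?_)
  rw [div_eq_mul_one_div, inv_sq_pow_eq (Lc := Lc) n]
  ring

/-- [folklore] **PART C, c-HALF, STEP FORM**: `‖(Lc^(n+2))^{D+4}·c_{Lc^(n+2)} − (Lc^(n+1))^{D+4}·c_{Lc^(n+1)}‖ ≤ (crPc D·(D·π²)²·√D·π∕Lc²)·(Lc⁻²)^n`. -/
theorem norm_unit_cSolQ_step_le (hLc : 1 ≤ Lc) (n : ℕ) (hq : ∀ i, |q i| ≤ π) (hq0 : q ≠ 0) (l : Fin D) :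
    ‖(((Lc ^ (n + 2) : ℕ) : ℂ)) ^ (D + 4) * cSol (Lc ^ (n + 2)) (ofRealVec q) 0 (eVec l)
        - (((Lc ^ (n + 1) : ℕ) : ℂ)) ^ (D + 4) * cSol (Lc ^ (n + 1)) (ofRealVec q) 0 (eVec l)‖
      ≤ (crPc D * ((D * π ^ 2) ^ 2 * (Real.sqrt D * π)) * ((Lc : ℝ) ^ 2)⁻¹) * (((Lc : ℝ) ^ 2)⁻¹) ^ n := by
  obtain ⟨h1, h2⟩ := one_le_pow_and_le hLc n
  haveI : NeZero (Lc ^ (n + 1)) := ⟨by positivity⟩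
  haveI : NeZero (Lc ^ (n + 2)) := ⟨by positivity⟩
  refine (norm_unit_cSolQ_sub_le_unif h1 h2 hq hq0 l).trans (le_of_eq ?_)
  rw [div_eq_mul_one_div, inv_sq_pow_eq (Lc := Lc) n]
  ring

end Step

end Summit.QuantumFields.BalabanUV.Beta.GAN24.FineReadoutCauchyCap

end
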